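import Summits.QuantumFields.YangMills.Theorems.ReplicaVarianceTiltLeafOfChiSqIncrement
import Literature.MathematicalPhysics.QuantumFieldTheory.Balaban1983to89.T3ThresholdRemoval

/-!
# Route `ReplicaVarianceTilt` (QuantumFields / YangMills; rung-R3 leaf `T3YM3TorusStatement.YM3TorusSU2`) — THE GLUE `LeafOfChiSq`
# (support item stmt-QuantumFields-26134), PROVED: `HeightChiSqL → HistoryTailL → YM3TorusSU2`

WHAT THIS IS NOT: not a proof of the route's crux `HeightChiSqL` (stmt-QuantumFields-26133, the replica chi-square cascade) nor of `HistoryTailL`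
(stmt-QuantumFields-19936) — both are hypotheses; no estimate of Bałaban's is proved, nothing bears on the Yang–Mills mass gap, and the rung R3
(`YM3TorusSU2`, a RECORD rung, not the Clay statement) stays open.  Measure theory + quantifier logic (width seat `ym-line-sfw-p2-w2` gen 16).

THE ARGUMENT.  Part 1 (`ReplicaVarianceTiltLeafOfChiSqIncrement`) turns the clause of `HeightChiSqL` at cut-off `K` plus the two large-field masses of
`HistoryTailL` into `|∫W dunitLaw(K+1) − ∫W dunitLaw K| ≤ 2√v_K + 4w_K` for measurable `|W| ≤ 1` (Cauchy–Schwarz in `L²(ρ⁰)`, data processing along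
`A_K = A_{⌊K/m⌋} ∘ D`, the four-measure lemma with a constant).  Here: `Σ (2√v_K + 4w_K) < ∞` makes the refined family's unit-law expectations of the
tree's bounded coarse observables Cauchy (`hasContinuumLimit_of_refine_increments`: `cauchySeq_of_dist_le_of_summable` + `T3ThresholdRemoval.expectAt_refine`),
and the quantifiers are discharged in the owner's order — thresholds `(b₁, p₁)` from the chi-square side at `L = F.L`, profile `(b₀, p₀)` from `HistoryTailL`,
`m` and `γ₃` from the chi-square side, `γ₂` from the tails, refinement depth `n` with `γL^{-n} ≤ min γ₂ γ₃` — then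
`T3ContinuumYM3Torus.continuumYM3Torus_iff_hasContinuumLimit_SU` gives the leaf's four conjuncts for `(F, γ)`.

References: C. King, CMP 102 (1986) 649–677 [King1986] (Thm 2.1 p.654, Thm 3.4 (3.9)–(3.13) pp.656–657); T. Bałaban, CMP 102 (1985) 255–275
[Balaban1985UV3] ((1)–(3) p.256).
-/

noncomputable section

open MeasureTheory Filter Topology
open Literature.MathematicalPhysics.QuantumFieldTheory.Balaban1983to89
open Literature.MathematicalPhysics.QuantumFieldTheory.Balaban1983to89.Missing
open Literature.MathematicalPhysics.QuantumFieldTheory.Balaban1983to89.T4Continuum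
open Literature.MathematicalPhysics.QuantumFieldTheory.Balaban1983to89.T3ContinuumYM3Torus
open Literature.MathematicalPhysics.QuantumFieldTheory.Balaban1983to89.T3UnitScaleTilt
open Literature.MathematicalPhysics.QuantumFieldTheory.Balaban1983to89.T3UnitLawDensityEML (ℰp measurableE_ℰp)
open Literature.MathematicalPhysics.QuantumFieldTheory.Balaban1983to89.T3ThresholdRemoval

namespace Summit.QuantumFields.YangMills.Theorems.LeafOfChiSq

/-! ## §5 Summable increments of the refined family's unit laws ⇒ the continuum limit of the original family -/

/-- **SUMMABLE TV-SHAPED INCREMENTS UNDER REFINEMENT ⇒ THE CONTINUUM LIMIT** (`γ ≥ 0`): if for the refined family `F.refine n` at coupling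
`γL^{-n}` every measurable unit-field observable `|W| ≤ 1` has `|∫W dunitLaw(K+1) − ∫W dunitLaw K| ≤ c_K` with `Σ c_K < ∞`, then the ORIGINAL family's
joint loop expectations converge (`HasContinuumLimit`): they are, from index `n` on, integrals of the bounded measurable `coarseObs` against the refined
unit laws (`T3ThresholdRemoval.expectAt_refine`), hence Cauchy (`cauchySeq_of_dist_le_of_summable`). [cite: King1986, Thm 2.1 p.654 and (3.13) p.657] -/
theorem hasContinuumLimit_of_refine_increments (F : T3Family) (n : ℕ) {γ : ℝ} (hγ : 0 ≤ γ) {c : ℕ → ℝ} (hc : Summable c)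
    (h : ∀ (K : ℕ) (W : GaugeField ((F.refine n).P 0) 0 (Matrix.specialUnitaryGroup (Fin 2) ℂ) → ℝ), Measurable W →
      (∀ u, |W u| ≤ 1) →
      |(∫ u, W u ∂(F.refine n).unitLaw ℰp measurableE_ℰp (γ * ((F.L : ℝ)⁻¹) ^ n) (K + 1)) -
          ∫ u, W u ∂(F.refine n).unitLaw ℰp measurableE_ℰp (γ * ((F.L : ℝ)⁻¹) ^ n) K| ≤ c K) :
    HasContinuumLimit (F.scheme ℰp γ) := by
  intro Cs
  have hcs : CauchySeq fun K =>
      ∫ u, coarseObs F n ℰp Cs u ∂(F.refine n).unitLaw ℰp measurableE_ℰp (γ * ((F.L : ℝ)⁻¹) ^ n) K :=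
    cauchySeq_of_dist_le_of_summable _
      (fun K => by
        rw [Real.dist_eq, abs_sub_comm]
        exact h K _ (measurable_coarseObs F n ℰp measurableE_ℰp Cs) (abs_coarseObs_le_one F n ℰp Cs)) hc
  obtain ⟨l, hl⟩ := cauchySeq_tendsto_of_complete hcs
  refine ⟨l, (tendsto_add_atTop_iff_nat n).mp ?_⟩
  have hkey : (fun K => (F.scheme ℰp γ).expectAt (K + n) Cs) =
      fun K => ∫ u, coarseObs F n ℰp Cs u ∂(F.refine n).unitLaw ℰp measurableE_ℰp (γ * ((F.L : ℝ)⁻¹) ^ n) K :=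
    funext fun K => expectAt_refine F n ℰp measurableE_ℰp hγ K Cs
  rw [hkey]
  exact hl

/-- Refinement depth below a threshold: for `γ > 0`, `γ₁ > 0`, `1 < L` there is `n` with `0 < γL^{-n} ≤ γ₁`. [folklore] -/
theorem exists_refine_depth {L : ℕ} (hL : 1 < L) {γ γ₁ : ℝ} (hγ : 0 < γ) (hγ₁ : 0 < γ₁) :
    ∃ n : ℕ, 0 < γ * ((L : ℝ)⁻¹) ^ n ∧ γ * ((L : ℝ)⁻¹) ^ n ≤ γ₁ := by
  have hL' : (1 : ℝ) < L := by exact_mod_cast hL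
  have hL0 : (0 : ℝ) < L := zero_lt_one.trans hL'
  obtain ⟨n, hn⟩ := ((tendsto_pow_atTop_nhds_zero_of_lt_one (inv_nonneg.mpr hL0.le)
    (inv_lt_one_of_one_lt₀ hL')).eventually (ge_mem_nhds (div_pos hγ₁ hγ))).exists
  refine ⟨n, mul_pos hγ (pow_pos (inv_pos.mpr hL0) n), ?_⟩
  have e := mul_le_mul_of_nonneg_left hn hγ.le
  rwa [mul_div_cancel₀ _ hγ.ne'] at e

end Summit.QuantumFields.YangMills.Theorems.LeafOfChiSq

namespace Summit.QuantumFields.YangMills.Theorems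

open LeafOfChiSq

/-! ## §6 The item -/

/-- **THE GLUE `LeafOfChiSq` OF ROUTE `ReplicaVarianceTilt` (support item stmt-QuantumFields-26134), PROVED**: `HeightChiSqL → HistoryTailL → YM3TorusSU2`
with the leaf's `γ₁ = 1`.  For a family `F` and `0 < γ`: thresholds `(b₁, p₁)` from `HeightChiSqL` at `L = F.L`; the profile `(b₀, p₀)` above them from
`HistoryTailL`; `m` and `γ₃` from `HeightChiSqL` at that profile; `γ₂` from `HistoryTailL` at `m`; a refinement depth `n` with `γL^{-n} ≤ min γ₂ γ₃`; at the
refined family the per-cut-off increments `2√v_K + 4w_K` (`LeafOfChiSq.abs_integral_unitLaw_succ_sub_le_of_chiSq`) are summable, so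
`hasContinuumLimit_of_refine_increments` and `T3ContinuumYM3Torus.continuumYM3Torus_iff_hasContinuumLimit_SU` give `ContinuumYM3Torus F ℰp γ`.  Nothing here
proves `HeightChiSqL`, `HistoryTailL`, the rung R3, or anything about the mass gap. [cite: King1986, Thm 3.4 (3.9)-(3.13) pp.656-657] -/
theorem replicaVarianceTilt_leafOfChiSq_proof :
    Summit.QuantumFields.YangMills.Theses.ReplicaVarianceTilt.LeafOfChiSq := by
  intro hV hT
  refine ⟨1, one_pos, fun F γ hγ _ => ?_⟩
  obtain ⟨b₁, p₁, hB⟩ := hV F.L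
  obtain ⟨b₀, p₀, hb₁, hp₁, hb₀, hp₀, hT'⟩ := hT F.L b₁ p₁
  obtain ⟨m, hm, γ₃, hγ₃, hS⟩ := hB b₀ p₀ hb₁ hp₁ hb₀ hp₀
  obtain ⟨γ₂, hγ₂, hT''⟩ := hT' m hm
  obtain ⟨n, hpos, hle⟩ := exists_refine_depth F.hL.2 hγ (lt_min hγ₂ hγ₃)
  obtain ⟨v, hvs, hv0, hK⟩ := hS (F.refine n) _ rfl hpos (hle.trans (min_le_right _ _))
  obtain ⟨w, hws, hw⟩ := hT'' (F.refine n) _ rfl hpos (hle.trans (min_le_left _ _))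
  refine (continuumYM3Torus_iff_hasContinuumLimit_SU F ℰp measurableE_ℰp hγ.le).mpr
    (hasContinuumLimit_of_refine_increments F n hγ.le ((hvs.mul_left 2).add (hws.mul_left 4)) fun K W hWm hW1 => ?_)
  obtain ⟨hac, hgi, hchi⟩ := hK K
  exact abs_integral_unitLaw_succ_sub_le_of_chiSq (F.refine n) hpos.le b₀ p₀ m K (hv0 K) hac hgi hchi
    (hw K).1 (hw K).2 hWm hW1

end Summit.QuantumFields.YangMills.Theorems

end
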